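import Summits.Ventures.PercRepro2.CaseOneEdgeSplit
import Summits.Ventures.PercRepro2.CaseOneRootLeafAlg
import Summits.Ventures.PercRepro2.CaseOneMarkLeafB
import Summits.Ventures.PercRepro2.CaseOneThickeningRel

/-!
# The root `a₁` pendant at the statement vertex: every such instance is closed
(blind cell PercRepro2, p1 g29; the first pendant-ROOT class — at `a₃` the pendant root IS a move)

Let `a₁` be a leaf at `a₃` through `e₀` of weight `q` (`a₂, o, b ≠ a₁`) and `G′ = G − e₀` with the
pair `(a₃, a₂)` in the role of the roots, `Q′ = {a₃ ↮ a₂}`. Under `Q = {a₁ ↮ a₂}` the event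
`{a₃ ∈ C₁}` is `{e₀ open}`, `Q` is `{e₀ closed} ∪ ({e₀ open} ∩ Q′)`, and the product law splits at
`e₀` (`prob_split_edge`): every mass of the case-1 forms at `a₃` is `(1 − q) · (a G′-mass without
`Q′`) + q · (a G′-mass with `Q′`)` — `probQ_rootLeaf`, `probQB_rootLeaf`, …, `Dpd_rootLeaf`,
`Dpdo_rootLeaf`, `Dqo_rootLeaf`. At the PD pair the forms COLLAPSE: `(ii) = q(1 − q) P(Q) ·
[P′(Q′) P′(Q′, b, o ∈ C₂) − P′(Q′, b ∈ C₂) P′(Q′, o ∈ C₂)]` (BHK 1.3 in `G′` for the cluster of `a₂`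
under `a₃ ↮ a₂`) and `(i) = q(1 − q) P(Q) · [P′(Q′, b ∈ C(a₃)) P′(Q′, o ∈ C₂) − P′(Q′) P′(Q′, b ∈ C(a₃),
o ∈ C₂)]` (BHK 1.4 across the clusters of `a₃`, `a₂`). At the Q pair, with `W = P(Q)`, `Y = P(Q, b ∈ C₂)`,
`d = P(Q, o ∈ U)`: `P′(Q′) · (ii-Q) = q [W² · (BHK 1.3 bracket) + (1 − q)(P′(b ∈ C₂) P′(Q′) − P′(Q′, b ∈ C₂))
(d P′(Q′) − W P′(Q′, o ∈ C₂))]` and `P′(Q′) · (i-Q) = q [W² · (BHK 1.4 bracket) + (1 − q) P′(Q′, b ∈ C(a₃))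
(d P′(Q′) − W P′(Q′, o ∈ C₂))]`, where the last factor is `(1 − q)(P′(o ∈ C₂) P′(Q′) − P′(Q′, o ∈ C₂)) +
q P′(Q′)(P′(Q′, o ∈ U′) − P′(Q′, o ∈ C₂)) ≥ 0` (Harris and containment). Hence
**`closedAt_of_a1_leaf_at_a3`**: a root pendant at the statement vertex is closed — for every graph
and every weight vector, with no hypothesis on `G′`. Own code; standard axioms.
-/

namespace Summit.Ventures.PercRepro2

namespace CaseOne

section RootLeaf
variable {V : Type*} {E : Type*} [Fintype E] [DecidableEq E] {R : Type*} [CommRing R]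
variable {ends : E → Sym2 V} {o a₁ a₂ a₃ b : V} {e₀ : E}

omit [Fintype E] in
/-- `a₁ ↔ a₂ ⟺ e₀ open ∧ a₂ ↔ a₃ in G − e₀`. -/
lemma conn_a1_a2_rootLeaf (hl : IsLeafAt ends a₃ a₁ e₀) (h2 : a₂ ≠ a₁) (ω : Config E) :
    Conn ends ω a₁ a₂ ↔ ω e₀ = true ∧
      Conn (restrictEnds ends e₀) (restrictCfg e₀ ω) a₂ a₃ := by
  rw [← conn_restrict_iff_of_leaf hl ω h2 hl.ne, ← conn_leaf_at_iff hl ω h2]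
  exact ⟨conn_symm, conn_symm⟩

omit [Fintype E] [DecidableEq E] in
/-- `a₁ ↔ a₃ ⟺ e₀ open`. -/
lemma conn_a1_a3_rootLeaf (hl : IsLeafAt ends a₃ a₁ e₀) (ω : Config E) :
    Conn ends ω a₁ a₃ ↔ ω e₀ = true := by
  rw [← conn_leaf_iff hl ω]
  exact ⟨conn_symm, conn_symm⟩

omit [Fintype E] in
/-- `a₁ ↔ x ⟺ e₀ open ∧ a₃ ↔ x in G − e₀` for `x ≠ a₁`. -/
lemma conn_a1_rootLeaf (hl : IsLeafAt ends a₃ a₁ e₀) {x : V} (hx : x ≠ a₁) (ω : Config E) :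
    Conn ends ω a₁ x ↔ ω e₀ = true ∧
      Conn (restrictEnds ends e₀) (restrictCfg e₀ ω) a₃ x := by
  constructor
  · intro h
    obtain ⟨he, hc⟩ := (conn_leaf_at_iff hl ω hx).1 (conn_symm h)
    exact ⟨he, (conn_restrict_iff_of_leaf hl ω hl.ne hx).1 (conn_symm hc)⟩
  · rintro ⟨he, hc⟩
    exact conn_symm ((conn_leaf_at_iff hl ω hx).2
      ⟨he, conn_symm ((conn_restrict_iff_of_leaf hl ω hl.ne hx).2 hc)⟩)

omit [Fintype E] in
/-- A connection among vertices `≠ a₁` is the same in `G − e₀`. -/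
lemma conn_rootLeaf (hl : IsLeafAt ends a₃ a₁ e₀) {x y : V} (hx : x ≠ a₁) (hy : y ≠ a₁)
    (ω : Config E) :
    Conn ends ω x y ↔ Conn (restrictEnds ends e₀) (restrictCfg e₀ ω) x y :=
  conn_restrict_iff_of_leaf hl ω hx hy

variable (p : E → R) (hl : IsLeafAt ends a₃ a₁ e₀) (h2 : a₂ ≠ a₁) (ho : o ≠ a₁) (hb : b ≠ a₁)
include hl h2

/-- `P(Q) = (1 − q) + q P′(Q′)`. -/
theorem probQ_rootLeaf :
    prob p (connEvent ends a₁ a₂)ᶜ = (1 - p e₀) +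
      p e₀ * prob (restrictW p e₀) (connEvent (restrictEnds ends e₀) a₂ a₃)ᶜ := by
  rw [prob_split_edge p e₀ _ Set.univ (connEvent (restrictEnds ends e₀) a₂ a₃)ᶜ, prob_univ, mul_one]
  intro ω
  simp only [Set.mem_compl_iff, mem_connEvent, Set.mem_univ, and_true]
  rw [conn_a1_a2_rootLeaf hl h2 ω]
  cases h : ω e₀ <;> simp

include hb in
/-- `P(Q, b ∈ C₂) = (1 − q) P′(b ∈ C₂) + q P′(Q′, b ∈ C₂)`. -/
theorem probQB_rootLeaf :
    prob p (connEvent ends a₂ b ∩ (connEvent ends a₁ a₂)ᶜ) =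
      (1 - p e₀) * prob (restrictW p e₀) (connEvent (restrictEnds ends e₀) a₂ b) +
      p e₀ * prob (restrictW p e₀) (connEvent (restrictEnds ends e₀) a₂ b ∩
        (connEvent (restrictEnds ends e₀) a₂ a₃)ᶜ) := by
  rw [prob_split_edge p e₀ _ (connEvent (restrictEnds ends e₀) a₂ b) (connEvent (restrictEnds ends e₀) a₂ b ∩ (connEvent (restrictEnds ends e₀) a₂ a₃)ᶜ)]
  intro ω
  simp only [Set.mem_inter_iff, Set.mem_compl_iff, mem_connEvent]
  rw [conn_a1_a2_rootLeaf hl h2 ω, conn_rootLeaf hl h2 hb ω]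
  cases h : ω e₀ <;> simp

/-- `P(Q, a₃ ∈ C₁) = q P′(Q′)`. -/
theorem probQA_rootLeaf :
    prob p (connEvent ends a₁ a₃ ∩ (connEvent ends a₁ a₂)ᶜ) =
      p e₀ * prob (restrictW p e₀) (connEvent (restrictEnds ends e₀) a₂ a₃)ᶜ := by
  rw [prob_split_edge p e₀ _ ∅ (connEvent (restrictEnds ends e₀) a₂ a₃)ᶜ, prob_empty, mul_zero,
    zero_add]
  intro ω
  simp only [Set.mem_inter_iff, Set.mem_compl_iff, mem_connEvent, Set.mem_empty_iff_false, and_false,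
    false_or]
  rw [conn_a1_a2_rootLeaf hl h2 ω, conn_a1_a3_rootLeaf hl ω]
  cases h : ω e₀ <;> simp

include ho in
/-- `P(Q, a₃ ∈ C₁, o ∈ C₂) = q P′(Q′, o ∈ C₂)`. -/
theorem probQAO_rootLeaf :
    prob p (connEvent ends a₁ a₃ ∩ connEvent ends a₂ o ∩ (connEvent ends a₁ a₂)ᶜ) =
      p e₀ * prob (restrictW p e₀) (connEvent (restrictEnds ends e₀) a₂ o ∩
        (connEvent (restrictEnds ends e₀) a₂ a₃)ᶜ) := by
  rw [prob_split_edge p e₀ _ ∅ (connEvent (restrictEnds ends e₀) a₂ o ∩ (connEvent (restrictEnds ends e₀) a₂ a₃)ᶜ), prob_empty, mul_zero, zero_add]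
  intro ω
  simp only [Set.mem_inter_iff, Set.mem_compl_iff, mem_connEvent, Set.mem_empty_iff_false, and_false,
    false_or]
  rw [conn_a1_a2_rootLeaf hl h2 ω, conn_a1_a3_rootLeaf hl ω, conn_rootLeaf hl h2 ho ω]
  cases h : ω e₀ <;> simp

include hb in
/-- `P(Q, b ∈ C₂, a₃ ∈ C₁) = q P′(Q′, b ∈ C₂)`. -/
theorem probQBA_rootLeaf :
    prob p (connEvent ends a₂ b ∩ connEvent ends a₁ a₃ ∩ (connEvent ends a₁ a₂)ᶜ) =
      p e₀ * prob (restrictW p e₀) (connEvent (restrictEnds ends e₀) a₂ b ∩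
        (connEvent (restrictEnds ends e₀) a₂ a₃)ᶜ) := by
  rw [prob_split_edge p e₀ _ ∅ (connEvent (restrictEnds ends e₀) a₂ b ∩ (connEvent (restrictEnds ends e₀) a₂ a₃)ᶜ), prob_empty, mul_zero, zero_add]
  intro ω
  simp only [Set.mem_inter_iff, Set.mem_compl_iff, mem_connEvent, Set.mem_empty_iff_false, and_false,
    false_or]
  rw [conn_a1_a2_rootLeaf hl h2 ω, conn_a1_a3_rootLeaf hl ω, conn_rootLeaf hl h2 hb ω]
  cases h : ω e₀ <;> simp

include ho hb in
/-- `P(Q, b ∈ C₂, a₃ ∈ C₁, o ∈ C₂) = q P′(Q′, b ∈ C₂, o ∈ C₂)`. -/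
theorem probQBAO_rootLeaf :
    prob p (connEvent ends a₂ b ∩ connEvent ends a₁ a₃ ∩ connEvent ends a₂ o ∩
      (connEvent ends a₁ a₂)ᶜ) =
      p e₀ * prob (restrictW p e₀) (connEvent (restrictEnds ends e₀) a₂ b ∩
        connEvent (restrictEnds ends e₀) a₂ o ∩ (connEvent (restrictEnds ends e₀) a₂ a₃)ᶜ) := by
  rw [prob_split_edge p e₀ _ ∅ (connEvent (restrictEnds ends e₀) a₂ b ∩ connEvent (restrictEnds ends e₀) a₂ o ∩ (connEvent (restrictEnds ends e₀) a₂ a₃)ᶜ), prob_empty, mul_zero, zero_add]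
  intro ω
  simp only [Set.mem_inter_iff, Set.mem_compl_iff, mem_connEvent, Set.mem_empty_iff_false, and_false,
    false_or]
  rw [conn_a1_a2_rootLeaf hl h2 ω, conn_a1_a3_rootLeaf hl ω, conn_rootLeaf hl h2 hb ω,
    conn_rootLeaf hl h2 ho ω]
  cases h : ω e₀ <;> simp

include hb in
/-- `P(Q, b ∈ C₁) = q P′(Q′, b ∈ C(a₃))`. -/
theorem probQB1_rootLeaf :
    prob p (connEvent ends a₁ b ∩ (connEvent ends a₁ a₂)ᶜ) =
      p e₀ * prob (restrictW p e₀) (connEvent (restrictEnds ends e₀) a₃ b ∩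
        (connEvent (restrictEnds ends e₀) a₂ a₃)ᶜ) := by
  rw [prob_split_edge p e₀ _ ∅ (connEvent (restrictEnds ends e₀) a₃ b ∩ (connEvent (restrictEnds ends e₀) a₂ a₃)ᶜ), prob_empty, mul_zero, zero_add]
  intro ω
  simp only [Set.mem_inter_iff, Set.mem_compl_iff, mem_connEvent, Set.mem_empty_iff_false, and_false,
    false_or]
  rw [conn_a1_a2_rootLeaf hl h2 ω, conn_a1_rootLeaf hl hb ω]
  cases h : ω e₀ <;> simp

include hb in
/-- `P(Q, b ∈ C₁, a₃ ∈ C₁) = q P′(Q′, b ∈ C(a₃))`. -/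
theorem probQB1A_rootLeaf :
    prob p (connEvent ends a₁ b ∩ connEvent ends a₁ a₃ ∩ (connEvent ends a₁ a₂)ᶜ) =
      p e₀ * prob (restrictW p e₀) (connEvent (restrictEnds ends e₀) a₃ b ∩
        (connEvent (restrictEnds ends e₀) a₂ a₃)ᶜ) := by
  rw [prob_split_edge p e₀ _ ∅ (connEvent (restrictEnds ends e₀) a₃ b ∩ (connEvent (restrictEnds ends e₀) a₂ a₃)ᶜ), prob_empty, mul_zero, zero_add]
  intro ω
  simp only [Set.mem_inter_iff, Set.mem_compl_iff, mem_connEvent, Set.mem_empty_iff_false, and_false,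
    false_or]
  rw [conn_a1_a2_rootLeaf hl h2 ω, conn_a1_a3_rootLeaf hl ω, conn_a1_rootLeaf hl hb ω]
  cases h : ω e₀ <;> simp

include ho hb in
/-- `P(Q, b ∈ C₁, a₃ ∈ C₁, o ∈ C₂) = q P′(Q′, b ∈ C(a₃), o ∈ C₂)`. -/
theorem probQB1AO_rootLeaf :
    prob p (connEvent ends a₁ b ∩ connEvent ends a₁ a₃ ∩ connEvent ends a₂ o ∩
      (connEvent ends a₁ a₂)ᶜ) =
      p e₀ * prob (restrictW p e₀) (connEvent (restrictEnds ends e₀) a₃ b ∩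
        connEvent (restrictEnds ends e₀) a₂ o ∩ (connEvent (restrictEnds ends e₀) a₂ a₃)ᶜ) := by
  rw [prob_split_edge p e₀ _ ∅ (connEvent (restrictEnds ends e₀) a₃ b ∩ connEvent (restrictEnds ends e₀) a₂ o ∩ (connEvent (restrictEnds ends e₀) a₂ a₃)ᶜ), prob_empty, mul_zero, zero_add]
  intro ω
  simp only [Set.mem_inter_iff, Set.mem_compl_iff, mem_connEvent, Set.mem_empty_iff_false, and_false,
    false_or]
  rw [conn_a1_a2_rootLeaf hl h2 ω, conn_a1_a3_rootLeaf hl ω, conn_a1_rootLeaf hl hb ω,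
    conn_rootLeaf hl h2 ho ω]
  cases h : ω e₀ <;> simp

/-- `D = (1 − q) P′(Q′)`. -/
theorem Dpd_rootLeaf :
    Dpd p ends a₁ a₂ a₃ = (1 - p e₀) * prob (restrictW p e₀) (connEvent (restrictEnds ends e₀) a₂ a₃)ᶜ := by
  unfold Dpd
  rw [prob_split_edge p e₀ _ (connEvent (restrictEnds ends e₀) a₂ a₃)ᶜ ∅, prob_empty, mul_zero, add_zero]
  intro ω
  simp only [Set.mem_inter_iff, Set.mem_compl_iff, mem_connEvent, Set.mem_empty_iff_false, and_false,
    or_false]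
  rw [conn_a1_a2_rootLeaf hl h2 ω, conn_a1_a3_rootLeaf hl ω, conn_rootLeaf hl h2 hl.ne ω]
  cases h : ω e₀ <;> simp

include ho in
/-- `D_o = (1 − q) P′(Q′, o ∈ C₂)`. -/
theorem Dpdo_rootLeaf :
    Dpdo p ends o a₁ a₂ a₃ = (1 - p e₀) * prob (restrictW p e₀)
      (connEvent (restrictEnds ends e₀) a₂ o ∩ (connEvent (restrictEnds ends e₀) a₂ a₃)ᶜ) := by
  unfold Dpdo
  rw [prob_split_edge p e₀ _ (connEvent (restrictEnds ends e₀) a₂ o ∩ (connEvent (restrictEnds ends e₀) a₂ a₃)ᶜ) ∅, prob_empty, mul_zero, add_zero]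
  intro ω
  simp only [Set.mem_inter_iff, Set.mem_union, Set.mem_compl_iff, mem_connEvent,
    Set.mem_empty_iff_false, and_false, or_false]
  rw [conn_a1_a2_rootLeaf hl h2 ω, conn_a1_a3_rootLeaf hl ω, conn_rootLeaf hl h2 hl.ne ω,
    conn_a1_rootLeaf hl ho ω, conn_rootLeaf hl h2 ho ω]
  cases h : ω e₀ <;> simp

include ho in
/-- `P(Q, o ∈ U) = (1 − q) P′(o ∈ C₂) + q P′(Q′, o ∈ U′)`. -/
theorem Dqo_rootLeaf :
    Dqo p ends o a₁ a₂ = (1 - p e₀) * prob (restrictW p e₀) (connEvent (restrictEnds ends e₀) a₂ o) +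
      p e₀ * prob (restrictW p e₀) ((connEvent (restrictEnds ends e₀) a₃ o ∪
        connEvent (restrictEnds ends e₀) a₂ o) ∩ (connEvent (restrictEnds ends e₀) a₂ a₃)ᶜ) := by
  unfold Dqo
  rw [prob_split_edge p e₀ _ (connEvent (restrictEnds ends e₀) a₂ o)
    ((connEvent (restrictEnds ends e₀) a₃ o ∪ connEvent (restrictEnds ends e₀) a₂ o) ∩ (connEvent (restrictEnds ends e₀) a₂ a₃)ᶜ)]
  intro ω
  simp only [Set.mem_inter_iff, Set.mem_union, Set.mem_compl_iff, mem_connEvent]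
  rw [conn_a1_a2_rootLeaf hl h2 ω, conn_a1_rootLeaf hl ho ω, conn_rootLeaf hl h2 ho ω]
  cases h : ω e₀ <;> simp

end RootLeaf

/-! ## The four forms -/

section Forms
variable {V : Type*} {E : Type*} [Fintype E] [DecidableEq E] [Fintype V] [DecidableEq V]
  {R : Type*} [CommRing R] [LinearOrder R] [IsStrictOrderedRing R]
variable {ends : E → Sym2 V} {o a₁ a₂ a₃ b : V} {e₀ : E}
variable {p : E → R} (hp : IsProbVec p) (hl : IsLeafAt ends a₃ a₁ e₀) (h2 : a₂ ≠ a₁) (ho : o ≠ a₁)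
  (hb : b ≠ a₁)
include hp hl h2 ho hb

/-- **`(ii)` for the root `a₁` pendant at the statement vertex.** -/
theorem zSplitII_of_a1_leaf_at_a3 : ZSplitII p ends o a₁ a₂ a₃ b := by
  rw [ZSplitII, iiExpr_eq_iiExprT, iiExprT_eq, probQBAO_rootLeaf p hl h2 ho hb,
    probQAO_rootLeaf p hl h2 ho, probQB_rootLeaf p hl h2 hb, probQBA_rootLeaf p hl h2 hb,
    probQA_rootLeaf p hl h2, probQ_rootLeaf p hl h2, Dpd_rootLeaf p hl h2, Dpdo_rootLeaf p hl h2 ho]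
  have hbhk := bhk_same_cluster_events (restrictW p e₀) (IsProbVec.restrictW hp e₀)
    (restrictEnds ends e₀) a₂ a₃ (isUpperSet_mem_setOf b) (isUpperSet_mem_setOf o)
  rw [← connEvent_eq_clusterInEvent _ a₂ b, ← connEvent_eq_clusterInEvent _ a₂ o] at hbhk
  have hq := hp.nonneg e₀
  have hq1 := sub_nonneg.2 (hp.le_one e₀)
  have hW : 0 ≤ (1 - p e₀) + p e₀ * prob (restrictW p e₀) (connEvent (restrictEnds ends e₀) a₂ a₃)ᶜ :=
    add_nonneg hq1 (mul_nonneg hq (prob_nonneg (IsProbVec.restrictW hp e₀) _))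
  have key := mul_nonneg (mul_nonneg (mul_nonneg hq hq1) hW) (sub_nonneg.2 hbhk)
  linear_combination key

/-- **`(i)` for the root `a₁` pendant at the statement vertex.** -/
theorem zSplitI_of_a1_leaf_at_a3 : ZSplitI p ends o a₁ a₂ a₃ b := by
  rw [ZSplitI, iExpr_eq_iExprT, iExprT_eq, probQB1AO_rootLeaf p hl h2 ho hb,
    probQAO_rootLeaf p hl h2 ho, probQB1_rootLeaf p hl h2 hb, probQB1A_rootLeaf p hl h2 hb,
    probQA_rootLeaf p hl h2, probQ_rootLeaf p hl h2, Dpd_rootLeaf p hl h2, Dpdo_rootLeaf p hl h2 ho]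
  have hbhk := bhk_cross_cluster (restrictW p e₀) (IsProbVec.restrictW hp e₀)
    (restrictEnds ends e₀) a₃ a₂ (isUpperSet_mem_setOf b) (isUpperSet_mem_setOf o)
  rw [← connEvent_eq_clusterInEvent _ a₃ b, ← connEvent_eq_clusterInEvent _ a₂ o,
    connEvent_comm _ a₃ a₂] at hbhk
  have hq := hp.nonneg e₀
  have hq1 := sub_nonneg.2 (hp.le_one e₀)
  have hW : 0 ≤ (1 - p e₀) + p e₀ * prob (restrictW p e₀) (connEvent (restrictEnds ends e₀) a₂ a₃)ᶜ :=
    add_nonneg hq1 (mul_nonneg hq (prob_nonneg (IsProbVec.restrictW hp e₀) _))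
  have key := mul_nonneg (mul_nonneg (mul_nonneg hq hq1) hW) (sub_nonneg.2 hbhk)
  linear_combination key

/-- **`(ii-Q)` for the root `a₁` pendant at the statement vertex.** -/
theorem zSplitIIQ_of_a1_leaf_at_a3 : ZSplitIIQ p ends o a₁ a₂ a₃ b := by
  have hp' := IsProbVec.restrictW hp e₀
  rw [ZSplitIIQ, iiExprT_eq, probQBAO_rootLeaf p hl h2 ho hb, probQAO_rootLeaf p hl h2 ho,
    probQB_rootLeaf p hl h2 hb, probQBA_rootLeaf p hl h2 hb, probQA_rootLeaf p hl h2,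
    probQ_rootLeaf p hl h2, Dqo_rootLeaf p hl h2 ho]
  have hbhk := bhk_same_cluster_events (restrictW p e₀) hp' (restrictEnds ends e₀) a₂ a₃
    (isUpperSet_mem_setOf b) (isUpperSet_mem_setOf o)
  rw [← connEvent_eq_clusterInEvent _ a₂ b, ← connEvent_eq_clusterInEvent _ a₂ o] at hbhk
  have hh1 := prob_inter_le_prob_mul_prob_of_isLowerSet hp'
    (isUpperSet_connEvent (restrictEnds ends e₀) a₂ a₃).compl
    (isUpperSet_connEvent (restrictEnds ends e₀) a₂ b)
  have hh2 := prob_inter_le_prob_mul_prob_of_isLowerSet hp'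
    (isUpperSet_connEvent (restrictEnds ends e₀) a₂ a₃).compl
    (isUpperSet_connEvent (restrictEnds ends e₀) a₂ o)
  rw [Set.inter_comm] at hh1 hh2
  have hmn : prob (restrictW p e₀) (connEvent (restrictEnds ends e₀) a₂ o ∩
      (connEvent (restrictEnds ends e₀) a₂ a₃)ᶜ) ≤ prob (restrictW p e₀)
      ((connEvent (restrictEnds ends e₀) a₃ o ∪ connEvent (restrictEnds ends e₀) a₂ o) ∩
        (connEvent (restrictEnds ends e₀) a₂ a₃)ᶜ) :=
    prob_mono hp' (Set.inter_subset_inter_left _ Set.subset_union_right)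
  have hu : prob (restrictW p e₀) (connEvent (restrictEnds ends e₀) a₂ b ∩
      connEvent (restrictEnds ends e₀) a₂ o ∩ (connEvent (restrictEnds ends e₀) a₂ a₃)ᶜ) ≤
      prob (restrictW p e₀) (connEvent (restrictEnds ends e₀) a₂ a₃)ᶜ :=
    prob_mono hp' Set.inter_subset_right
  exact rootLeaf_iiQ_alg (hp.nonneg e₀) (hp.le_one e₀) (prob_nonneg hp' _) (prob_nonneg hp' _)
    (prob_nonneg hp' _) (prob_nonneg hp' _) hu hbhk hh1 hh2 hmn

/-- **`(i-Q)` for the root `a₁` pendant at the statement vertex.** -/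
theorem zSplitIQ_of_a1_leaf_at_a3 : ZSplitIQ p ends o a₁ a₂ a₃ b := by
  have hp' := IsProbVec.restrictW hp e₀
  rw [ZSplitIQ, iExprT_eq, probQB1AO_rootLeaf p hl h2 ho hb, probQAO_rootLeaf p hl h2 ho,
    probQB1_rootLeaf p hl h2 hb, probQB1A_rootLeaf p hl h2 hb, probQA_rootLeaf p hl h2,
    probQ_rootLeaf p hl h2, Dqo_rootLeaf p hl h2 ho]
  have hbhk := bhk_cross_cluster (restrictW p e₀) hp' (restrictEnds ends e₀) a₃ a₂
    (isUpperSet_mem_setOf b) (isUpperSet_mem_setOf o)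
  rw [← connEvent_eq_clusterInEvent _ a₃ b, ← connEvent_eq_clusterInEvent _ a₂ o,
    connEvent_comm _ a₃ a₂] at hbhk
  have hh2 := prob_inter_le_prob_mul_prob_of_isLowerSet hp'
    (isUpperSet_connEvent (restrictEnds ends e₀) a₂ a₃).compl
    (isUpperSet_connEvent (restrictEnds ends e₀) a₂ o)
  rw [Set.inter_comm] at hh2
  have hmn : prob (restrictW p e₀) (connEvent (restrictEnds ends e₀) a₂ o ∩
      (connEvent (restrictEnds ends e₀) a₂ a₃)ᶜ) ≤ prob (restrictW p e₀)
      ((connEvent (restrictEnds ends e₀) a₃ o ∪ connEvent (restrictEnds ends e₀) a₂ o) ∩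
        (connEvent (restrictEnds ends e₀) a₂ a₃)ᶜ) :=
    prob_mono hp' (Set.inter_subset_inter_left _ Set.subset_union_right)
  have hu : prob (restrictW p e₀) (connEvent (restrictEnds ends e₀) a₃ b ∩
      connEvent (restrictEnds ends e₀) a₂ o ∩ (connEvent (restrictEnds ends e₀) a₂ a₃)ᶜ) ≤
      prob (restrictW p e₀) (connEvent (restrictEnds ends e₀) a₂ a₃)ᶜ :=
    prob_mono hp' Set.inter_subset_right
  exact rootLeaf_iQ_alg (hp.nonneg e₀) (hp.le_one e₀) (prob_nonneg hp' _) (prob_nonneg hp' _)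
    (prob_nonneg hp' _) (prob_nonneg hp' _) (prob_nonneg hp' _) (prob_nonneg hp' _) hu hbhk hh2 hmn

/-- **The four forms for the root `a₁` pendant at the statement vertex.** -/
theorem fourForms_of_a1_leaf_at_a3 : FourForms p ends o a₁ a₂ a₃ b :=
  ⟨zSplitII_of_a1_leaf_at_a3 hp hl h2 ho hb, zSplitIIQ_of_a1_leaf_at_a3 hp hl h2 ho hb,
    zSplitI_of_a1_leaf_at_a3 hp hl h2 ho hb, zSplitIQ_of_a1_leaf_at_a3 hp hl h2 ho hb⟩

end Forms

section Closed
universe u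
variable {V : Type*} [Fintype V] [DecidableEq V] {R : Type*} [CommRing R] [LinearOrder R]
  [IsStrictOrderedRing R] {E : Type u} [Fintype E] [DecidableEq E] {ends : E → Sym2 V}
  {o a₁ a₂ a₃ b : V} {e₀ : E}

/-- **The root `a₁` pendant at the statement vertex is closed** (`a₂, o, b ≠ a₁`). -/
theorem closedAt_of_a1_leaf_at_a3 (hl : IsLeafAt ends a₃ a₁ e₀) (h2 : a₂ ≠ a₁) (ho : o ≠ a₁)
    (hb : b ≠ a₁) : ClosedAt R o a₁ a₂ b E ends a₃ :=
  fun _ hp => fourForms_of_a1_leaf_at_a3 hp hl h2 ho hb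

end Closed

end CaseOne

end Summit.Ventures.PercRepro2
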